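import Summits.BirchSwinnertonDyer.BirchSwinnertonDyer.Theorems.EisensteinDepletionAtTwoStarOptBSFSigmaNodeCusp
import HarnessLib

/-!
# Preliminaries for stub S4 `stub_etaleLiftSecondPoint` of line `star` v18 (crux E1M, stmt-BirchSwinnertonDyer-20341): integrality of an étale
# 2-torsion abscissa, the mod-4 / mod-32 bookkeeping of `α² − 32β = 1`, and the second étale root (lead star-p1 GEN 21, 2026-08-29)

Elementary lemmas used by `Theorems/EisensteinDepletionAtTwoStarEtaleLiftSecondPoint.lean` (the étale twin of the node law): no number theory
beyond the rational/integral root theorem; nothing here reads `r_an`; E1M / BSD are NOT proved by this file.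
-/

set_option linter.dupNamespace false
set_option autoImplicit false

noncomputable section

open scoped Classical MatrixGroups PeriodPair
open CongruenceSubgroup Polynomial
open WeierstrassCurve Literature.NumberTheory.EllipticCurves Literature.NumberTheory.EllipticCurves.Greenberg1999
open Literature.NumberTheory.EllipticCurves.ModularForms

namespace Summit.BirchSwinnertonDyer.BirchSwinnertonDyer.Theorems.DepletionAtTwo.SigmaNode

/-! ### Small lemmas -/

/-- A rational 2-torsion abscissa of a globally minimal curve that is NOT ramified at `2` is an integer. [cite: SilvermanAEC2009, VIII.7] -/
theorem exists_int_eq_of_etale (W₀ : WeierstrassCurve ℚ) [W₀.IsElliptic] [W₀.IsGloballyMinimal] {x : ℚ}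
    (hx : HasRationalTwoTorsionX W₀ x) (hnr : ¬ TwoTorsionRamifiedAtTwo x) : ∃ ξ : ℤ, (ξ : ℚ) = x := by
  obtain ⟨y, hEq, h2⟩ := hx
  have hcub := PrimeConductorTwoTorsion.cubic_eq_zero W₀ hEq h2
  have hb₂ : W₀.b₂ = ((WeierstrassCurve.integralModelInt W₀).b₂ : ℚ) := by
    conv_lhs => rw [← WeierstrassCurve.map_integralModelInt W₀]
    rw [WeierstrassCurve.map_b₂, eq_intCast]
  have hb₄ : W₀.b₄ = ((WeierstrassCurve.integralModelInt W₀).b₄ : ℚ) := by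
    conv_lhs => rw [← WeierstrassCurve.map_integralModelInt W₀]
    rw [WeierstrassCurve.map_b₄, eq_intCast]
  have hb₆ : W₀.b₆ = ((WeierstrassCurve.integralModelInt W₀).b₆ : ℚ) := by
    conv_lhs => rw [← WeierstrassCurve.map_integralModelInt W₀]
    rw [WeierstrassCurve.map_b₆, eq_intCast]
  rw [hb₂, hb₄, hb₆] at hcub
  obtain ⟨ζ, hζ⟩ := PrimeConductorTwoTorsion.exists_int_eq_of_cubic (WeierstrassCurve.integralModelInt W₀) hcub
  -- `x = ζ/4` with `ord₂ x ≥ 0` forces `4 ∣ ζ`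
  have hxζ : x = (ζ : ℚ) / 4 := by rw [hζ]; ring
  rw [TwoTorsionRamifiedAtTwo, not_lt] at hnr
  by_cases hζ0 : ζ = 0
  · exact ⟨0, by rw [hxζ, hζ0]; simp⟩
  have hv : (2 : ℤ) ≤ padicValInt 2 ζ := by
    rw [hxζ, padicValRat.div (by exact_mod_cast hζ0) (by norm_num), padicValRat.of_int,
      show (4 : ℚ) = ((2 ^ 2 : ℕ) : ℚ) by norm_num, padicValRat.of_nat, padicValNat.prime_pow] at hnr
    push_cast at hnr
    linarith
  have h4 : (4 : ℤ) ∣ ζ := by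
    have h := (padicValInt_dvd_iff 2 ζ).mpr (Or.inr (by exact_mod_cast hv : 2 ≤ padicValInt 2 ζ))
    simpa using h
  obtain ⟨ξ, rfl⟩ := h4
  exact ⟨ξ, by rw [hxζ]; push_cast; ring⟩

/-- Squares are `0` or `1` mod `4`: `a² ≠ 32b − 1`. [folklore] -/
theorem sq_ne_thirtytwo_mul_sub_one (a b : ℤ) : a ^ 2 - 32 * b ≠ -1 := by
  intro h
  have h4 : a ^ 2 % 4 = 3 := by omega
  rcases Int.emod_two_eq_zero_or_one a with ha | ha
  · have : a ^ 2 % 4 = 0 := by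
      obtain ⟨m, hm⟩ : ∃ m, a = 2 * m := ⟨a / 2, by omega⟩
      subst hm; ring_nf; omega
    omega
  · have : a ^ 2 % 4 = 1 := by
      obtain ⟨m, hm⟩ : ∃ m, a = 2 * m + 1 := ⟨a / 2, by omega⟩
      subst hm; ring_nf; omega
    omega

/-- From `α² − 1 = 32β`: `16 ∣ α − 1` or `16 ∣ α + 1`. [folklore] -/
theorem sixteen_dvd_of_sq_sub_one {α β : ℤ} (h : α ^ 2 - 32 * β = 1) : (16 : ℤ) ∣ α - 1 ∨ (16 : ℤ) ∣ α + 1 := by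
  have hmod : ((α : ZMod 32)) ^ 2 = 1 := by
    have h1 := congr_arg (fun t : ℤ ↦ (t : ZMod 32)) h
    push_cast at h1
    have h32 : (32 : ZMod 32) = 0 := by decide
    rw [h32, zero_mul, sub_zero] at h1
    exact h1
  have key : ∀ a : ZMod 32, a ^ 2 = 1 → a = 1 ∨ a = 15 ∨ a = 17 ∨ a = 31 := by decide
  have hc : ∀ c : ℤ, (α : ZMod 32) = (c : ZMod 32) → (32 : ℤ) ∣ α - c := fun c hc ↦ by
    have h0 : ((α - c : ℤ) : ZMod 32) = 0 := by push_cast; rw [hc, sub_self]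
    exact_mod_cast (ZMod.intCast_zmod_eq_zero_iff_dvd (α - c) 32).mp h0
  rcases key _ hmod with h1 | h1 | h1 | h1
  · have := hc 1 (by rw [h1]; push_cast; rfl); omega
  · have := hc 15 (by rw [h1]; push_cast; rfl); omega
  · have := hc 17 (by rw [h1]; push_cast; rfl); omega
  · have := hc 31 (by rw [h1]; push_cast; rfl); omega

/-- **The second étale root.**  If `x = ξ ∈ ℤ` is a rational 2-torsion abscissa with `α = b₂ + 12x`, `β = b₄ + xb₂ + 6x² ≠ 0` and
`α² − 32β = 1`, then `x + r`, `r = −(α ∓ 1)/8 ∈ 2ℤ ∖ {0}`, is a second rational 2-torsion abscissa, not ramified at `2`.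
[cite: SilvermanAEC2009, III.1] -/
theorem exists_second_etale_root (W₀ : WeierstrassCurve ℚ) {x : ℚ} {ξ αz βz : ℤ} (hξ : (ξ : ℚ) = x)
    (hαcast : W₀.b₂ + 12 * x = (αz : ℚ)) (hβcast : W₀.b₄ + x * W₀.b₂ + 6 * x ^ 2 = (βz : ℚ)) (hβ0 : βz ≠ 0)
    (hx : HasRationalTwoTorsionX W₀ x) (hD1' : αz ^ 2 - 32 * βz = 1) :
    ∃ x₁ : ℚ, x₁ ≠ x ∧ HasRationalTwoTorsionX W₀ x₁ ∧ ¬ TwoTorsionRamifiedAtTwo x₁ := by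
  -- the expansion `cubic(x + X) = cubic(x) + X(4X² + αX + 2β)` and `cubic(x) = 0`
  have hcubx : 4 * x ^ 3 + W₀.b₂ * x ^ 2 + 2 * W₀.b₄ * x + W₀.b₆ = 0 := by
    obtain ⟨y, hEq, h2⟩ := hx
    linear_combination (1 / 16 : ℚ) * PrimeConductorTwoTorsion.cubic_eq_zero W₀ hEq h2
  have hroot : ∀ r : ℚ, 4 * r ^ 2 + (αz : ℚ) * r + 2 * βz = 0 →
      4 * (x + r) ^ 3 + W₀.b₂ * (x + r) ^ 2 + 2 * W₀.b₄ * (x + r) + W₀.b₆ = 0 := by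
    intro r hr
    have e : 4 * (x + r) ^ 3 + W₀.b₂ * (x + r) ^ 2 + 2 * W₀.b₄ * (x + r) + W₀.b₆ =
        (4 * x ^ 3 + W₀.b₂ * x ^ 2 + 2 * W₀.b₄ * x + W₀.b₆) +
          r * (4 * r ^ 2 + (W₀.b₂ + 12 * x) * r + 2 * (W₀.b₄ + x * W₀.b₂ + 6 * x ^ 2)) := by ring
    rw [e, hcubx, hαcast, hβcast, hr]; ring
  have htors : ∀ r : ℚ, 4 * r ^ 2 + (αz : ℚ) * r + 2 * βz = 0 → HasRationalTwoTorsionX W₀ (x + r) := by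
    intro r hr
    refine ⟨-(W₀.a₁ * (x + r) + W₀.a₃) / 2, ?_, by ring⟩
    rw [WeierstrassCurve.Affine.equation_iff]
    have h := hroot r hr
    simp only [WeierstrassCurve.b₂, WeierstrassCurve.b₄, WeierstrassCurve.b₆] at h
    linear_combination (-1 / 4 : ℚ) * h
  -- choose the sign with `16 ∣ α ∓ 1`
  rcases sixteen_dvd_of_sq_sub_one hD1' with ⟨t, ht⟩ | ⟨t, ht⟩
  · -- `α = 16t + 1`, `β = 8t² + t`, `r = −2t`
    have hα : αz = 16 * t + 1 := by omega
    have hβt : βz = 8 * t ^ 2 + t := by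
      have h1 : (16 * t + 1) ^ 2 - 32 * βz = 1 := by rw [← hα]; exact hD1'
      have h32 : (32 : ℤ) * βz = 32 * (8 * t ^ 2 + t) := by linear_combination (-1 : ℤ) * h1
      exact mul_left_cancel₀ (by norm_num) h32
    have ht0 : t ≠ 0 := by rintro rfl; apply hβ0; rw [hβt]; ring
    refine ⟨x + ((-2 * t : ℤ) : ℚ), ?_, htors _ ?_, ?_⟩
    · intro h
      have h0 : ((-2 * t : ℤ) : ℚ) = 0 := by linear_combination h
      have h0' : (-2 * t : ℤ) = 0 := by exact_mod_cast h0
      exact ht0 (by clear * - h0'; omega)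
    · have hαq : (αz : ℚ) = 16 * t + 1 := by exact_mod_cast hα
      have hβq : (βz : ℚ) = 8 * t ^ 2 + t := by exact_mod_cast hβt
      rw [hαq, hβq]; push_cast; ring
    · rw [TwoTorsionRamifiedAtTwo, not_lt, ← hξ, show ((ξ : ℚ) + ((-2 * t : ℤ) : ℚ)) = ((ξ - 2 * t : ℤ) : ℚ) by push_cast; ring,
        padicValRat.of_int]
      exact Int.natCast_nonneg _
  · -- `α = 16t − 1`, `β = 8t² − t`, `r = −2t`
    have hα : αz = 16 * t - 1 := by omega
    have hβt : βz = 8 * t ^ 2 - t := by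
      have h1 : (16 * t - 1) ^ 2 - 32 * βz = 1 := by rw [← hα]; exact hD1'
      have h32 : (32 : ℤ) * βz = 32 * (8 * t ^ 2 - t) := by linear_combination (-1 : ℤ) * h1
      exact mul_left_cancel₀ (by norm_num) h32
    have ht0 : t ≠ 0 := by rintro rfl; apply hβ0; rw [hβt]; ring
    refine ⟨x + ((-2 * t : ℤ) : ℚ), ?_, htors _ ?_, ?_⟩
    · intro h
      have h0 : ((-2 * t : ℤ) : ℚ) = 0 := by linear_combination h
      have h0' : (-2 * t : ℤ) = 0 := by exact_mod_cast h0
      exact ht0 (by clear * - h0'; omega)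
    · have hαq : (αz : ℚ) = 16 * t - 1 := by exact_mod_cast hα
      have hβq : (βz : ℚ) = 8 * t ^ 2 - t := by exact_mod_cast hβt
      rw [hαq, hβq]; push_cast; ring
    · rw [TwoTorsionRamifiedAtTwo, not_lt, ← hξ, show ((ξ : ℚ) + ((-2 * t : ℤ) : ℚ)) = ((ξ - 2 * t : ℤ) : ℚ) by push_cast; ring,
        padicValRat.of_int]
      exact Int.natCast_nonneg _

end Summit.BirchSwinnertonDyer.BirchSwinnertonDyer.Theorems.DepletionAtTwo.SigmaNode

end
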